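import Mathlib
import Summits.Ventures.PercRepro2.SwOutAll
import Summits.Ventures.PercRepro2.SwOutSeriesDefs
import Summits.Ventures.PercRepro2.SwOutSeriesContract
import Summits.Ventures.PercRepro2.SwOutSeriesContractCount
import Summits.Ventures.PercRepro2.SwOutSeriesDelete
import Summits.Ventures.PercRepro2.SwOutSeriesDeleteCount
import Summits.Ventures.PercRepro2.SwOutSeriesThm
import Summits.Ventures.PercRepro2.SwOutLeaf
import Summits.Ventures.PercRepro2.SwOutLeafThm
import Summits.Ventures.PercRepro2.SwOutLoop
import Summits.Ventures.PercRepro2.SwOutLoopThm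

/-!
# Series-reducible regions (blind cell PercRepro2, night-4 g10, 2026-08-25; proofs/NIGHT4-G10.md
§2, §4 — the induction of the cycle theorem as one statement)

`RigidOK ends l h o U ξ` is the rigid counting inequality of (HLC) on the class `(U, ξ)` for every
up-set of edge sets.  `Reducible l h o ends U` is the inductive predicate «the region reduces, by
contracting / deleting series vertices, peeling leaves without outside edges (never a mark) and
parking loops at `l`, to regions on which `RigidOK` holds for every outside colouring».
**`rigidOK_of_reducible`**: every reducible region satisfies `RigidOK` for every outside colouring —
Theorems S, L and P assembled; `swAll_of_reducible`, `sw_of_reducible`: the rigid row 2′SW-ALL and row (SW) on every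
graph whose region `V ∖ {l}` is reducible.  The cycle theorem (paper, NIGHT4-G10.md §4) is the
statement that a cycle region through `h` is reducible to base regions whose non-mark vertices
all carry an outside edge, whose `RigidOK` is the cube principle (Theorem B, paper).
-/

namespace Summit.Ventures.PercRepro2

namespace LocRows

open Hull

variable {V : Type*} {E : Type*} [Fintype E] [DecidableEq E]

open scoped Classical

variable (ends : E → Sym2 V) (l h o : V)

/-- The rigid counting inequality of (HLC) on the class `(U, ξ)` for every up-set of edge sets. -/
def RigidOK (U : Set V) (ξ : Config E) : Prop :=
  ∀ 𝓔 : Set (Set E), IsUpperSet 𝓔 →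
    ((swOutSide ends l h o U ξ).filter fun ζ => redEdges ends ζ h ∈ 𝓔).card ≤
      ((swOutSide ends l h o U ξ).filter fun ζ => blueEdges ends ζ h ∈ 𝓔).card

/-- Series-reducible regions: the base regions (where the rigid inequality is granted for every
outside colouring), and the regions obtained by re-attaching a series vertex or a leaf without
outside edges that is not a mark. -/
inductive Reducible : (E → Sym2 V) → Set V → Prop
  | base (ends : E → Sym2 V) (U : Set V) (hbase : ∀ ξ, RigidOK ends l h o U ξ) : Reducible ends U
  | series (ends : E → Sym2 V) (U : Set V) (u p q : V) (e₁ e₂ : E)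
      (hs : IsSeriesAt ends u p q e₁ e₂) (hu : u ∈ U) (hp : p ∈ U) (huh : u ≠ h) (hul : u ≠ l)
      (huo : u ≠ o) (hC : Reducible (contractSeries ends u p q e₁ e₂) (U \ {u}))
      (hD : Reducible (deleteSeries ends u e₁ e₂) (U \ {u})) : Reducible ends U
  | leaf (ends : E → Sym2 V) (U : Set V) (u p : V) (e₁ : E) (hs : IsLeafAt ends u p e₁)
      (hu : u ∈ U) (huh : u ≠ h) (hul : u ≠ l) (huo : u ≠ o)
      (hD : Reducible (deleteLeaf ends u e₁) (U \ {u})) : Reducible ends U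
  | loop (ends : E → Sym2 V) (U : Set V) (p : V) (e₁ : E) (hs : ends e₁ = s(p, p)) (hp : p ∈ U)
      (hl : l ∉ U) (hD : Reducible (parkLoop ends l e₁) U) : Reducible ends U

/-- **Every series-reducible region satisfies the rigid counting inequality for every outside
colouring** (Theorem S and Theorem L assembled along the reduction). -/
theorem rigidOK_of_reducible {ends : E → Sym2 V} {U : Set V} (hr : Reducible l h o ends U) :
    ∀ ξ, RigidOK ends l h o U ξ := by
  induction hr with
  | base ends U hbase => exact hbase
  | series ends U u p q e₁ e₂ hs hu hp huh hul huo _ _ ihC ihD =>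
    intro ξ 𝓔 h𝓔
    exact card_le_of_series hs hu hp huh hul huo (ihC (Function.update ξ e₁ false))
      (ihD (Function.update (Function.update ξ e₂ false) e₁ false)) h𝓔
  | leaf ends U u p e₁ hs hu huh hul huo _ ihD =>
    intro ξ 𝓔 h𝓔
    exact card_le_of_leaf hs hu huh hul huo (ihD (Function.update ξ e₁ false)) h𝓔
  | loop ends U p e₁ hs hp hl _ ihD =>
    intro ξ 𝓔 h𝓔
    exact card_le_of_loop hs hl hp (ihD (Function.update ξ e₁ false)) h𝓔

/-- The rigid form of (HLC) on a reducible region with `h ∈ U`, `l ∉ U`: the class injection. -/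
theorem exists_swAll_injection_of_reducible {ends : E → Sym2 V} {U : Set V}
    (hr : Reducible l h o ends U) (ξ : Config E) :
    ∃ f : {ζ // ζ ∈ swOutSide ends l h o U ξ} → Config E, Function.Injective f ∧
      ∀ x, f x ∈ swOutSide ends l h o U ξ ∧
        ∀ e, e ∈ within ends (cluster ends x.1 h) → x.1 e = true → f x e = false :=
  exists_swAll_injection_of_card_le h _ (rigidOK_of_reducible l h o hr ξ)

/-- **(SW) in its rigid form on every graph whose region `V ∖ {l}` is series-reducible**: the
classes indexed by the colouring of the loops at `l` glue (the proof of `swAll_of_swOutAll`, with the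
single region `{l}ᶜ`). -/
theorem swAll_of_reducible {ends : E → Sym2 V} (hlh : l ≠ h)
    (hr : Reducible l h o ends ({l}ᶜ)) : SwAll ends l h o := by
  have hU : h ∈ ({l}ᶜ : Set V) := by simpa using hlh.symm
  choose f hf using fun ξ : Config E => exists_swAll_injection_of_reducible l h o hr ξ
  have hmem : ∀ ζ ∈ tgtU ends l h {S : Set V | o ∈ S},
      ζ ∈ swOutSide ends l h o ({l}ᶜ) (outRep ends ({l}ᶜ) ζ) := by
    intro ζ hζ
    rw [mem_swOutSide, mem_outClass]
    refine ⟨hζ, ?_, ?_⟩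
    · intro e he
      simp only [outRep, he, if_false]
    · intro x hx hxl
      simp only [Set.mem_singleton_iff] at hxl
      subst hxl
      exact l_notMem_hull_of_mem_tgtU hζ hx
  refine ⟨fun x => f (outRep ends ({l}ᶜ) x.1) ⟨x.1, hmem x.1 x.2⟩, ?_, ?_⟩
  · intro x y hxy
    have hx := ((hf (outRep ends ({l}ᶜ) x.1)).2 ⟨x.1, hmem x.1 x.2⟩).1
    have hy := ((hf (outRep ends ({l}ᶜ) y.1)).2 ⟨y.1, hmem y.1 y.2⟩).1
    rw [mem_swOutSide, mem_outClass] at hx hy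
    have h1 := outRep_eq_of_agree (ends := ends) (U := {l}ᶜ) (ζ := outRep ends ({l}ᶜ) x.1)
      (ζ' := f (outRep ends ({l}ᶜ) x.1) ⟨x.1, hmem x.1 x.2⟩) hx.2.1
    have h2 := outRep_eq_of_agree (ends := ends) (U := {l}ᶜ) (ζ := outRep ends ({l}ᶜ) y.1)
      (ζ' := f (outRep ends ({l}ᶜ) y.1) ⟨y.1, hmem y.1 y.2⟩) hy.2.1
    have hidem : ∀ ζ : Config E, outRep ends ({l}ᶜ) (outRep ends ({l}ᶜ) ζ) = outRep ends ({l}ᶜ) ζ := by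
      intro ζ; funext e; simp only [outRep]; split_ifs <;> rfl
    have hrep : outRep ends ({l}ᶜ) x.1 = outRep ends ({l}ᶜ) y.1 := by
      rw [← hidem x.1, ← hidem y.1, ← h1, ← h2]
      simp only at hxy
      rw [hxy]
    have hinj := (hf (outRep ends ({l}ᶜ) x.1)).1
    have hcast : ∀ (ξ₁ ξ₂ : Config E) (hξ : ξ₁ = ξ₂) (a : {ζ // ζ ∈ swOutSide ends l h o ({l}ᶜ) ξ₁})
        (b : {ζ // ζ ∈ swOutSide ends l h o ({l}ᶜ) ξ₂}), a.1 = b.1 → f ξ₁ a = f ξ₂ b := by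
      intro ξ₁ ξ₂ hξ a b hab
      subst hξ
      rw [Subtype.ext hab]
    have hy' : y.1 ∈ swOutSide ends l h o ({l}ᶜ) (outRep ends ({l}ᶜ) x.1) := by
      rw [hrep]; exact hmem y.1 y.2
    have hxy' : f (outRep ends ({l}ᶜ) x.1) ⟨x.1, hmem x.1 x.2⟩ =
        f (outRep ends ({l}ᶜ) x.1) ⟨y.1, hy'⟩ := by
      simp only at hxy
      rw [hxy]
      exact hcast _ _ hrep.symm _ _ rfl
    have key := hinj hxy'
    have hval : x.1 = y.1 := Subtype.mk.inj key
    exact Subtype.ext hval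
  · intro x
    have hx := (hf (outRep ends ({l}ᶜ) x.1)).2 ⟨x.1, hmem x.1 x.2⟩
    refine ⟨?_, hx.2⟩
    exact (mem_swOutSide.1 hx.1).1

/-- **Row (SW) on every graph whose region `V ∖ {l}` is series-reducible.** -/
theorem sw_of_reducible {ends : E → Sym2 V} (hlh : l ≠ h) (hr : Reducible l h o ends ({l}ᶜ)) :
    Sw ends l h o :=
  sw_of_swAll ends (swAll_of_reducible l h o hlh hr)

end LocRows

end Summit.Ventures.PercRepro2
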